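import Mathlib
import HarnessLib
import Summits.ValiantsHypothesis.ValiantsHypothesis.Theorems.LacunarySymmetroidMatrixDescartesProductPlusOneClusterCellEveryK
import Summits.ValiantsHypothesis.ValiantsHypothesis.Theorems.LacunarySymmetroidMatrixDescartesProductPlusOneRowTowerKMasterLawSwitched

/-!
# LINE (A) `product_plus_one` — the FULL CLUSTER CELL for every K: both sides of the root

Support `d : Fin (n+2) → ℕ` (`StrictMono d`), rows `f_j = Σ_l C (a j l) X^{d l}`, window `(u,v)` (`0 < u`), threshold `p : ℕ`, `0 < p`.  THE MENU (per row)
extends ✓ `…ClusterCellEveryK` (two-cluster rows on either side, master rows «knee cluster of width ≤ p below, poles ≥ p above, anywhere» on the UNSWITCHED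
side, clouds) by the mirror class: SWITCHED MASTER rows — a cut `k`, one sign up to `k`, the other above; the TOP cluster (letters `> k`) of width `≤ p`
(`k < l ⇒ d l' ≤ d l + p` for active `l, l'`), every low letter at least `p` below every active top letter, at least two active letters, and the window
on the SWITCHED side (`f_j` has the TOP cluster's sign on `(u,v)`).  Law: ✓ `rowPsiK3_master_law_switched`, strict by a far low letter
(✓ `…_switched_far` / `…_far0`) or, when every low letter sits at exactly `σ − p` (then there is exactly one), by the two-cluster law.
THEN ★★ `fullClusterCellEveryK_wronskian_roots_le_two`: `W(∏_j f_j)` has AT MOST TWO roots in `(u,v)`; ★★ `fullClusterCellEveryK_eulerNumerator_roots_le_three`: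
every `eulerNumerator d a l₀` (unfolded) has AT MOST THREE.  Summary of the symmetric picture (threshold `p`, row = low cluster ∪ high cluster of opposite
signs, cross gaps `≥ p`): low width `≤ p` ⇒ free on the unswitched side; high width `≤ p` ⇒ free on the switched side; both ⇒ free everywhere.

Honest framing: ONE W-cell family (helper; every K); nothing closes a stub; the fast-knee cell (#19), `WronskianBudgetK3`, `OneChangeFloorK3`, `stub_classRowK3`,
`stub_polyLaw`, 18050 `MatrixDescartes`, Conjecture B are NOT proved; `VP ≠ VNP` NOT proved.  No definitions, no named facts.
-/

set_option linter.dupNamespace false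

namespace Summit.ValiantsHypothesis.ValiantsHypothesis.Theorems.LacunarySymmetroidMatrixDescartes

namespace ProductPlusOne

open Finset Set Polynomial
open scoped BigOperators Topology Polynomial

/-- ★ **ROW LAW, switched master row** (low letters `≥ 0` up to the cut `k`, high letters `≤ 0` above it forming a cluster of width `≤ p`, every active
low letter `≥ p` below every active high letter, at least two active letters, `x > 0` with `f(x) < 0`): the stripped row is non-zero and `p²ψ₁ < ψ₃`.
[this file's theorem] -/
theorem rowLawsAt_master_switched_pos {n : ℕ} (d : Fin (n + 2) → ℕ) (hd : StrictMono d) (b : Fin (n + 2) → ℝ) (p : ℕ) (k : Fin (n + 2))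
    (hlow : ∀ l, l ≤ k → 0 ≤ b l) (hhigh : ∀ l, k < l → b l ≤ 0)
    (hact : ∃ l l', l ≠ l' ∧ b l ≠ 0 ∧ b l' ≠ 0)
    (hwidth : ∀ l l', b l ≠ 0 → b l' ≠ 0 → k < l → d l' ≤ d l + p)
    (hsep : ∀ l l', b l ≠ 0 → b l' ≠ 0 → l ≤ k → k < l' → d l + p ≤ d l')
    {x : ℝ} (hx0 : 0 < x) (hfx : (∑ l, C (b l) * X ^ (d l) : ℝ[X]).eval x < 0) :
    b 0 - ∑ l : Fin (n + 1), (-(b l.succ)) * x ^ (d l.succ - d 0) ≠ 0 ∧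
    (p : ℝ) ^ 2 * rowPsiK1 (fun l : Fin (n + 1) => d l.succ - d 0) (b 0) (fun l : Fin (n + 1) => -(b l.succ)) x
      < rowPsiK3 (fun l : Fin (n + 1) => d l.succ - d 0) (b 0) (fun l : Fin (n + 1) => -(b l.succ)) x := by
  classical
  have hd0 : ∀ l, d 0 ≤ d l := fun l => hd.monotone (Fin.zero_le l)
  set lam : Fin (n + 1) → ℕ := fun l => d l.succ - d 0 with hlam
  set B : Fin (n + 1) → ℝ := fun l => -(b l.succ) with hBdef
  have hF : b 0 - ∑ l : Fin (n + 1), B l * x ^ (lam l) < 0 := by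
    rw [eval_rowK_eq d hd0 b x] at hfx
    by_contra hcon
    push Not at hcon
    exact absurd hfx (not_lt.2 (mul_nonneg (pow_pos hx0 _).le hcon))
  refine ⟨hF.ne, ?_⟩
  have hk0 : (0 : Fin (n + 2)) ≤ k := Fin.zero_le k
  -- an active HIGH letter exists (else `f(x) ≥ 0`)
  have hpole : ∃ l, k < l ∧ b l ≠ 0 := by
    by_contra hnone
    push Not at hnone
    have hle : 0 ≤ (∑ l, C (b l) * X ^ (d l) : ℝ[X]).eval x := by
      rw [eval_finsetSum]
      refine Finset.sum_nonneg fun l _ => ?_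
      rw [eval_mul, eval_C, eval_pow, eval_X]
      rcases le_or_gt l k with h | h
      · exact mul_nonneg (hlow l h) (pow_pos hx0 _).le
      · rw [hnone l h]; simp
    linarith
  obtain ⟨l₂, hl₂k, hl₂⟩ := hpole
  obtain ⟨l₁, hl₁mem, hl₁min⟩ := Finset.exists_min_image (Finset.univ.filter fun l => k < l ∧ b l ≠ 0) d
    ⟨l₂, Finset.mem_filter.2 ⟨Finset.mem_univ _, hl₂k, hl₂⟩⟩
  obtain ⟨hl₁k, hl₁⟩ := (Finset.mem_filter.1 hl₁mem).2
  have hmin : ∀ l, k < l → b l ≠ 0 → d l₁ ≤ d l := fun l h1 h2 => hl₁min l (Finset.mem_filter.2 ⟨Finset.mem_univ _, h1, h2⟩)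
  set σ : ℕ := d l₁ - d 0 with hσ
  have hkneeOf : ∀ l : Fin (n + 1), B l < 0 → l.succ ≤ k := by
    intro l hl
    by_contra h
    push Not at h
    have := hhigh l.succ h
    simp only [hBdef] at hl; linarith
  have hpoleOf : ∀ l : Fin (n + 1), 0 < B l → k < l.succ := by
    intro l hl
    by_contra h
    push Not at h
    have := hlow l.succ h
    simp only [hBdef] at hl; linarith
  have hBne : ∀ l : Fin (n + 1), B l ≠ 0 → b l.succ ≠ 0 := fun l hl => by simpa [hBdef] using hl
  have hA : 0 ≤ b 0 := hlow 0 hk0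
  have h0 : b 0 ≠ 0 → p ≤ σ := by
    intro hb0
    have := hsep 0 l₁ hb0 hl₁ hk0 hl₁k
    simp only [hσ]; omega
  have hhigh' : ∀ l, 0 < B l → σ ≤ lam l ∧ lam l ≤ σ + p := by
    intro l hl
    have hlk := hpoleOf l hl
    have hbl := hBne l hl.ne'
    have h1 := hmin l.succ hlk hbl
    have h2 := hwidth l₁ l.succ hl₁ hbl hl₁k
    have := hd0 l.succ; have := hd0 l₁
    constructor <;> simp only [hlam, hσ] <;> omega
  have hlow' : ∀ l, B l < 0 → lam l + p ≤ σ := by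
    intro l hl
    have hlk := hkneeOf l hl
    have hbl := hBne l hl.ne
    have := hsep l.succ l₁ hbl hl₁ hlk hl₁k
    have := hd0 l.succ
    simp only [hlam, hσ]; omega
  by_cases hfar : ∃ l, l ≤ k ∧ b l ≠ 0 ∧ d l + p < d l₁
  · obtain ⟨l, hlk, hbl, hdl⟩ := hfar
    rcases Fin.eq_zero_or_eq_succ l with h | ⟨i, hi⟩
    · subst h
      refine rowPsiK3_gt_of_master_switched_far0 lam (b 0) B p σ hx0 hF hA h0 hhigh' hlow' hbl ?_
      simp only [hσ]; omega
    · subst hi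
      refine rowPsiK3_gt_of_master_switched_far lam (b 0) B p σ hx0 hF hA h0 hhigh' hlow' ⟨i, ?_, ?_⟩
      · have := hlow i.succ hlk
        have hne : b i.succ ≠ 0 := hbl
        simp only [hBdef]
        rcases lt_or_eq_of_le this with h | h
        · linarith
        · exact absurd h.symm hne
      · have := hd0 i.succ
        simp only [hlam, hσ]; omega
  · -- every low letter sits at exactly `d l₁ − p`: one low letter, the row is two-cluster
    push Not at hfar
    have hlowdeg : ∀ l, l ≤ k → b l ≠ 0 → d l + p = d l₁ := by
      intro l hlk hbl
      have h1 := hfar l hlk hbl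
      have h2 := hsep l l₁ hbl hl₁ hlk hl₁k
      omega
    have hwidth2 : ∀ l l', b l ≠ 0 → b l' ≠ 0 → (l' ≤ k ∨ k < l) → d l' ≤ d l + p := by
      intro l l' hl hl' h
      rcases h with h | h
      · rcases le_or_gt l k with h' | h'
        · have e1 := hlowdeg l h' hl
          have e2 := hlowdeg l' h hl'
          omega
        · have : d l' < d l := hd (lt_of_le_of_lt h h')
          omega
      · rcases le_or_gt l' k with h' | h'
        · have : d l' < d l := hd (lt_of_le_of_lt h' h)
          omega
        · exact hwidth l l' hl hl' h
    exact (rowLawsAt_twoCluster_pos d hd b p k hlow hhigh hact hwidth2 hsep hx0 hfx.ne).2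

/-- ★ **THE FULL CLUSTER MENU ROW LAW**: a menu row (two-cluster / cloud / master / switched master, either sign pattern) has, on `(u,v)`, a non-vanishing
stripped form and `p²ψ₁ < ψ₃`. [this file's theorem] -/
theorem fullClusterRow_law {n : ℕ} (d : Fin (n + 2) → ℕ) (hd : StrictMono d) (b : Fin (n + 2) → ℝ) {u v : ℝ} (hu : 0 < u) (p : ℕ)
    (hrowj :
      (((((∃ k : Fin (n + 2),
        (((∀ l, l ≤ k → 0 ≤ b l) ∧ (∀ l, k < l → b l ≤ 0)) ∨ ((∀ l, l ≤ k → b l ≤ 0) ∧ (∀ l, k < l → 0 ≤ b l))) ∧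
        (∃ l l', l ≠ l' ∧ b l ≠ 0 ∧ b l' ≠ 0) ∧
        (∀ l l', b l ≠ 0 → b l' ≠ 0 → (l' ≤ k ∨ k < l) → d l' ≤ d l + p) ∧
        (∀ l l', b l ≠ 0 → b l' ≠ 0 → l ≤ k → k < l' → d l + p ≤ d l') ∧
        (∀ x ∈ Ioo u v, (∑ l, C (b l) * X ^ (d l) : ℝ[X]).eval x ≠ 0)) ∨
      ((∀ l : Fin (n + 1), b 0 * b l.succ ≤ 0) ∧ (∃ l : Fin (n + 1), b l.succ ≠ 0) ∧ (∀ l : Fin (n + 1), b l.succ ≠ 0 → p ≤ d l.succ - d 0) ∧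
          0 < b 0 * (∑ l, C (b l) * X ^ (d l) : ℝ[X]).eval v)) ∨
      (∃ k : Fin (n + 2),
        (((∀ l, l ≤ k → 0 ≤ b l) ∧ (∀ l, k < l → b l ≤ 0) ∧ (∀ x ∈ Ioo u v, 0 < (∑ l, C (b l) * X ^ (d l) : ℝ[X]).eval x)) ∨
          ((∀ l, l ≤ k → b l ≤ 0) ∧ (∀ l, k < l → 0 ≤ b l) ∧ (∀ x ∈ Ioo u v, (∑ l, C (b l) * X ^ (d l) : ℝ[X]).eval x < 0))) ∧
        (∃ l l', l ≠ l' ∧ b l ≠ 0 ∧ b l' ≠ 0) ∧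
        (∀ l l', b l ≠ 0 → b l' ≠ 0 → l' ≤ k → d l' ≤ d l + p) ∧
        (∀ l l', b l ≠ 0 → b l' ≠ 0 → l ≤ k → k < l' → d l + p ≤ d l')))) ∨
      (∃ k : Fin (n + 2),
        (((∀ l, l ≤ k → 0 ≤ b l) ∧ (∀ l, k < l → b l ≤ 0) ∧ (∀ x ∈ Ioo u v, (∑ l, C (b l) * X ^ (d l) : ℝ[X]).eval x < 0)) ∨
          ((∀ l, l ≤ k → b l ≤ 0) ∧ (∀ l, k < l → 0 ≤ b l) ∧ (∀ x ∈ Ioo u v, 0 < (∑ l, C (b l) * X ^ (d l) : ℝ[X]).eval x))) ∧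
        (∃ l l', l ≠ l' ∧ b l ≠ 0 ∧ b l' ≠ 0) ∧
        (∀ l l', b l ≠ 0 → b l' ≠ 0 → k < l → d l' ≤ d l + p) ∧
        (∀ l l', b l ≠ 0 → b l' ≠ 0 → l ≤ k → k < l' → d l + p ≤ d l'))))
    {x : ℝ} (hx : x ∈ Ioo u v) :
    b 0 - ∑ l : Fin (n + 1), (-(b l.succ)) * x ^ (d l.succ - d 0) ≠ 0 ∧
    (p : ℝ) ^ 2 * rowPsiK1 (fun l : Fin (n + 1) => d l.succ - d 0) (b 0) (fun l : Fin (n + 1) => -(b l.succ)) x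
      < rowPsiK3 (fun l : Fin (n + 1) => d l.succ - d 0) (b 0) (fun l : Fin (n + 1) => -(b l.succ)) x := by
  have hx0 : 0 < x := hu.trans hx.1
  rcases hrowj with hg | ⟨k, hsign, hact, hwidth, hsep⟩
  · exact clusterRow_law d hd b hu p hg hx
  · rcases hsign with ⟨hlow, hhigh, hneg⟩ | ⟨hlow, hhigh, hpos⟩
    · exact rowLawsAt_master_switched_pos d hd b p k hlow hhigh hact hwidth hsep hx0 (hneg x hx)
    · -- flip the row
      have hlow' : ∀ l, l ≤ k → 0 ≤ (fun l => -b l) l := fun l hl => by simp only; linarith [hlow l hl]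
      have hhigh' : ∀ l, k < l → (fun l => -b l) l ≤ 0 := fun l hl => by simp only; linarith [hhigh l hl]
      have hact' : ∃ l l', l ≠ l' ∧ (fun l => -b l) l ≠ 0 ∧ (fun l => -b l) l' ≠ 0 := by
        obtain ⟨l, l', hll', hl, hl'⟩ := hact; exact ⟨l, l', hll', neg_ne_zero.2 hl, neg_ne_zero.2 hl'⟩
      have hwidth' : ∀ l l', (fun l => -b l) l ≠ 0 → (fun l => -b l) l' ≠ 0 → k < l → d l' ≤ d l + p :=
        fun l l' hl hl' h => hwidth l l' (neg_ne_zero.1 hl) (neg_ne_zero.1 hl') h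
      have hsep' : ∀ l l', (fun l => -b l) l ≠ 0 → (fun l => -b l) l' ≠ 0 → l ≤ k → k < l' → d l + p ≤ d l' :=
        fun l l' hl hl' h1 h2 => hsep l l' (neg_ne_zero.1 hl) (neg_ne_zero.1 hl') h1 h2
      have hfx' : (∑ l, C ((fun l => -b l) l) * X ^ (d l) : ℝ[X]).eval x < 0 := by
        simp only
        rw [eval_rowK_neg d b x]; linarith [hpos x hx]
      exact (rowLawAt_neg_iff d b (p : ℝ) x).1
        (rowLawsAt_master_switched_pos d hd (fun l => -b l) p k hlow' hhigh' hact' hwidth' hsep' hx0 hfx')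

/-- ★★ **THE FULL CLUSTER CELL FOR EVERY K**: `W(∏_j f_j)` has AT MOST TWO roots in `(u,v)`. [this file's theorem] -/
theorem fullClusterCellEveryK_wronskian_roots_le_two {m n : ℕ} (d : Fin (n + 2) → ℕ) (hd : StrictMono d)
    (a : Fin m → Fin (n + 2) → ℝ) {u v : ℝ} (hu : 0 < u) (p : ℕ) (hp : 0 < p)
    (hrow : ∀ j,
      (((((∃ k : Fin (n + 2),
        (((∀ l, l ≤ k → 0 ≤ a j l) ∧ (∀ l, k < l → a j l ≤ 0)) ∨ ((∀ l, l ≤ k → a j l ≤ 0) ∧ (∀ l, k < l → 0 ≤ a j l))) ∧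
        (∃ l l', l ≠ l' ∧ a j l ≠ 0 ∧ a j l' ≠ 0) ∧
        (∀ l l', a j l ≠ 0 → a j l' ≠ 0 → (l' ≤ k ∨ k < l) → d l' ≤ d l + p) ∧
        (∀ l l', a j l ≠ 0 → a j l' ≠ 0 → l ≤ k → k < l' → d l + p ≤ d l') ∧
        (∀ x ∈ Ioo u v, (∑ l, C (a j l) * X ^ (d l) : ℝ[X]).eval x ≠ 0)) ∨
      ((∀ l : Fin (n + 1), a j 0 * a j l.succ ≤ 0) ∧ (∃ l : Fin (n + 1), a j l.succ ≠ 0) ∧ (∀ l : Fin (n + 1), a j l.succ ≠ 0 → p ≤ d l.succ - d 0) ∧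
          0 < a j 0 * (∑ l, C (a j l) * X ^ (d l) : ℝ[X]).eval v)) ∨
      (∃ k : Fin (n + 2),
        (((∀ l, l ≤ k → 0 ≤ a j l) ∧ (∀ l, k < l → a j l ≤ 0) ∧ (∀ x ∈ Ioo u v, 0 < (∑ l, C (a j l) * X ^ (d l) : ℝ[X]).eval x)) ∨
          ((∀ l, l ≤ k → a j l ≤ 0) ∧ (∀ l, k < l → 0 ≤ a j l) ∧ (∀ x ∈ Ioo u v, (∑ l, C (a j l) * X ^ (d l) : ℝ[X]).eval x < 0))) ∧
        (∃ l l', l ≠ l' ∧ a j l ≠ 0 ∧ a j l' ≠ 0) ∧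
        (∀ l l', a j l ≠ 0 → a j l' ≠ 0 → l' ≤ k → d l' ≤ d l + p) ∧
        (∀ l l', a j l ≠ 0 → a j l' ≠ 0 → l ≤ k → k < l' → d l + p ≤ d l')))) ∨
      (∃ k : Fin (n + 2),
        (((∀ l, l ≤ k → 0 ≤ a j l) ∧ (∀ l, k < l → a j l ≤ 0) ∧ (∀ x ∈ Ioo u v, (∑ l, C (a j l) * X ^ (d l) : ℝ[X]).eval x < 0)) ∨
          ((∀ l, l ≤ k → a j l ≤ 0) ∧ (∀ l, k < l → 0 ≤ a j l) ∧ (∀ x ∈ Ioo u v, 0 < (∑ l, C (a j l) * X ^ (d l) : ℝ[X]).eval x))) ∧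
        (∃ l l', l ≠ l' ∧ a j l ≠ 0 ∧ a j l' ≠ 0) ∧
        (∀ l l', a j l ≠ 0 → a j l' ≠ 0 → k < l → d l' ≤ d l + p) ∧
        (∀ l l', a j l ≠ 0 → a j l' ≠ 0 → l ≤ k → k < l' → d l + p ≤ d l')))) :
    (((∏ j, ∑ l, C (a j l) * X ^ (d l) : ℝ[X]) * (X * derivative (X * derivative (∏ j, ∑ l, C (a j l) * X ^ (d l) : ℝ[X])))
        - (X * derivative (∏ j, ∑ l, C (a j l) * X ^ (d l) : ℝ[X])) ^ 2).roots.toFinset.filter (fun t => u < t ∧ t < v)).card ≤ 2 :=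
  wronskianK_roots_le_two_of_rowLawsAt d hd a hu p hp fun j _ hx => fullClusterRow_law d hd (a j) hu p (hrow j) hx

/-- No menu row vanishes on the window. [this file's lemma] -/
theorem fullClusterCellEveryK_eval_ne_zero {m n : ℕ} (d : Fin (n + 2) → ℕ) (hd : StrictMono d)
    (a : Fin m → Fin (n + 2) → ℝ) {u v : ℝ} (hu : 0 < u) (p : ℕ)
    (hrow : ∀ j,
      (((((∃ k : Fin (n + 2),
        (((∀ l, l ≤ k → 0 ≤ a j l) ∧ (∀ l, k < l → a j l ≤ 0)) ∨ ((∀ l, l ≤ k → a j l ≤ 0) ∧ (∀ l, k < l → 0 ≤ a j l))) ∧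
        (∃ l l', l ≠ l' ∧ a j l ≠ 0 ∧ a j l' ≠ 0) ∧
        (∀ l l', a j l ≠ 0 → a j l' ≠ 0 → (l' ≤ k ∨ k < l) → d l' ≤ d l + p) ∧
        (∀ l l', a j l ≠ 0 → a j l' ≠ 0 → l ≤ k → k < l' → d l + p ≤ d l') ∧
        (∀ x ∈ Ioo u v, (∑ l, C (a j l) * X ^ (d l) : ℝ[X]).eval x ≠ 0)) ∨
      ((∀ l : Fin (n + 1), a j 0 * a j l.succ ≤ 0) ∧ (∃ l : Fin (n + 1), a j l.succ ≠ 0) ∧ (∀ l : Fin (n + 1), a j l.succ ≠ 0 → p ≤ d l.succ - d 0) ∧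
          0 < a j 0 * (∑ l, C (a j l) * X ^ (d l) : ℝ[X]).eval v)) ∨
      (∃ k : Fin (n + 2),
        (((∀ l, l ≤ k → 0 ≤ a j l) ∧ (∀ l, k < l → a j l ≤ 0) ∧ (∀ x ∈ Ioo u v, 0 < (∑ l, C (a j l) * X ^ (d l) : ℝ[X]).eval x)) ∨
          ((∀ l, l ≤ k → a j l ≤ 0) ∧ (∀ l, k < l → 0 ≤ a j l) ∧ (∀ x ∈ Ioo u v, (∑ l, C (a j l) * X ^ (d l) : ℝ[X]).eval x < 0))) ∧
        (∃ l l', l ≠ l' ∧ a j l ≠ 0 ∧ a j l' ≠ 0) ∧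
        (∀ l l', a j l ≠ 0 → a j l' ≠ 0 → l' ≤ k → d l' ≤ d l + p) ∧
        (∀ l l', a j l ≠ 0 → a j l' ≠ 0 → l ≤ k → k < l' → d l + p ≤ d l')))) ∨
      (∃ k : Fin (n + 2),
        (((∀ l, l ≤ k → 0 ≤ a j l) ∧ (∀ l, k < l → a j l ≤ 0) ∧ (∀ x ∈ Ioo u v, (∑ l, C (a j l) * X ^ (d l) : ℝ[X]).eval x < 0)) ∨
          ((∀ l, l ≤ k → a j l ≤ 0) ∧ (∀ l, k < l → 0 ≤ a j l) ∧ (∀ x ∈ Ioo u v, 0 < (∑ l, C (a j l) * X ^ (d l) : ℝ[X]).eval x))) ∧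
        (∃ l l', l ≠ l' ∧ a j l ≠ 0 ∧ a j l' ≠ 0) ∧
        (∀ l l', a j l ≠ 0 → a j l' ≠ 0 → k < l → d l' ≤ d l + p) ∧
        (∀ l l', a j l ≠ 0 → a j l' ≠ 0 → l ≤ k → k < l' → d l + p ≤ d l'))))
    {x : ℝ} (hx : x ∈ Ioo u v) (j : Fin m) : (∑ l, C (a j l) * X ^ (d l) : ℝ[X]).eval x ≠ 0 := by
  have hd0 : ∀ l, d 0 ≤ d l := fun l => hd.monotone (Fin.zero_le l)
  have hx0 : 0 < x := hu.trans hx.1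
  rw [eval_rowK_eq d hd0 (a j) x]
  exact mul_ne_zero (pow_ne_zero _ hx0.ne') (fullClusterRow_law d hd (a j) hu p (hrow j) hx).1

/-- ★★ **THE FULL CLUSTER CELL IN THE FLOOR'S CURRENCY**: for every coupling `l₀`, `eulerNumerator d a l₀` (unfolded) has AT MOST THREE zeros in `(u,v)`.
[this file's theorem] -/
theorem fullClusterCellEveryK_eulerNumerator_roots_le_three {m n : ℕ} (d : Fin (n + 2) → ℕ) (hd : StrictMono d)
    (a : Fin m → Fin (n + 2) → ℝ) (l₀ : Fin (n + 2)) {u v : ℝ} (hu : 0 < u) (p : ℕ) (hp : 0 < p)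
    (hrow : ∀ j,
      (((((∃ k : Fin (n + 2),
        (((∀ l, l ≤ k → 0 ≤ a j l) ∧ (∀ l, k < l → a j l ≤ 0)) ∨ ((∀ l, l ≤ k → a j l ≤ 0) ∧ (∀ l, k < l → 0 ≤ a j l))) ∧
        (∃ l l', l ≠ l' ∧ a j l ≠ 0 ∧ a j l' ≠ 0) ∧
        (∀ l l', a j l ≠ 0 → a j l' ≠ 0 → (l' ≤ k ∨ k < l) → d l' ≤ d l + p) ∧
        (∀ l l', a j l ≠ 0 → a j l' ≠ 0 → l ≤ k → k < l' → d l + p ≤ d l') ∧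
        (∀ x ∈ Ioo u v, (∑ l, C (a j l) * X ^ (d l) : ℝ[X]).eval x ≠ 0)) ∨
      ((∀ l : Fin (n + 1), a j 0 * a j l.succ ≤ 0) ∧ (∃ l : Fin (n + 1), a j l.succ ≠ 0) ∧ (∀ l : Fin (n + 1), a j l.succ ≠ 0 → p ≤ d l.succ - d 0) ∧
          0 < a j 0 * (∑ l, C (a j l) * X ^ (d l) : ℝ[X]).eval v)) ∨
      (∃ k : Fin (n + 2),
        (((∀ l, l ≤ k → 0 ≤ a j l) ∧ (∀ l, k < l → a j l ≤ 0) ∧ (∀ x ∈ Ioo u v, 0 < (∑ l, C (a j l) * X ^ (d l) : ℝ[X]).eval x)) ∨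
          ((∀ l, l ≤ k → a j l ≤ 0) ∧ (∀ l, k < l → 0 ≤ a j l) ∧ (∀ x ∈ Ioo u v, (∑ l, C (a j l) * X ^ (d l) : ℝ[X]).eval x < 0))) ∧
        (∃ l l', l ≠ l' ∧ a j l ≠ 0 ∧ a j l' ≠ 0) ∧
        (∀ l l', a j l ≠ 0 → a j l' ≠ 0 → l' ≤ k → d l' ≤ d l + p) ∧
        (∀ l l', a j l ≠ 0 → a j l' ≠ 0 → l ≤ k → k < l' → d l + p ≤ d l')))) ∨
      (∃ k : Fin (n + 2),
        (((∀ l, l ≤ k → 0 ≤ a j l) ∧ (∀ l, k < l → a j l ≤ 0) ∧ (∀ x ∈ Ioo u v, (∑ l, C (a j l) * X ^ (d l) : ℝ[X]).eval x < 0)) ∨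
          ((∀ l, l ≤ k → a j l ≤ 0) ∧ (∀ l, k < l → 0 ≤ a j l) ∧ (∀ x ∈ Ioo u v, 0 < (∑ l, C (a j l) * X ^ (d l) : ℝ[X]).eval x))) ∧
        (∃ l l', l ≠ l' ∧ a j l ≠ 0 ∧ a j l' ≠ 0) ∧
        (∀ l l', a j l ≠ 0 → a j l' ≠ 0 → k < l → d l' ≤ d l + p) ∧
        (∀ l l', a j l ≠ 0 → a j l' ≠ 0 → l ≤ k → k < l' → d l + p ≤ d l')))) :
    ((∑ j, (∑ l, C (a j l * ((d l : ℝ) - d l₀)) * X ^ (d l)) * ∏ i ∈ Finset.univ.erase j, (∑ l, C (a i l) * X ^ (d l))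
        : ℝ[X]).roots.toFinset.filter (fun t => u < t ∧ t < v)).card ≤ 3 := by
  classical
  refine roots_Ioo_card_le_of_Icc _ 3 fun u' v' hu' hv' => ?_
  rcases lt_or_ge v' u' with hvu | huv'
  · have : ((∑ j, (∑ l, C (a j l * ((d l : ℝ) - d l₀)) * X ^ (d l)) * ∏ i ∈ Finset.univ.erase j, (∑ l, C (a i l) * X ^ (d l))
        : ℝ[X]).roots.toFinset.filter (fun t => u' ≤ t ∧ t ≤ v')) = ∅ :=
      Finset.filter_eq_empty_iff.2 fun t _ h => by linarith [h.1, h.2]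
    rw [this]; simp
  have hu'0 : 0 < u' := hu.trans hu'
  have hP : ∀ t ∈ Set.Icc u' v', (∏ j, (∑ l, C (a j l) * X ^ (d l) : ℝ[X])).eval t ≠ 0 := by
    intro t ht
    rw [eval_prod]
    exact Finset.prod_ne_zero_iff.2 fun j _ =>
      fullClusterCellEveryK_eval_ne_zero d hd a hu p hrow ⟨hu'.trans_le ht.1, ht.2.trans_lt hv'⟩ j
  have h1 := eulerNumerator_roots_Icc_le_wronskian_roots_add_one d a l₀ hu'0 hP
  have h2 := fullClusterCellEveryK_wronskian_roots_le_two d hd a hu p hp hrow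
  have h3 : (((∏ j, ∑ l, C (a j l) * X ^ (d l) : ℝ[X]) * (X * derivative (X * derivative (∏ j, ∑ l, C (a j l) * X ^ (d l) : ℝ[X])))
            - (X * derivative (∏ j, ∑ l, C (a j l) * X ^ (d l) : ℝ[X])) ^ 2).roots.toFinset.filter (fun w => u' < w ∧ w < v')).card
      ≤ (((∏ j, ∑ l, C (a j l) * X ^ (d l) : ℝ[X]) * (X * derivative (X * derivative (∏ j, ∑ l, C (a j l) * X ^ (d l) : ℝ[X])))
            - (X * derivative (∏ j, ∑ l, C (a j l) * X ^ (d l) : ℝ[X])) ^ 2).roots.toFinset.filter (fun t => u < t ∧ t < v)).card := by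
    refine Finset.card_le_card fun t ht => ?_
    have ht' := Finset.mem_filter.1 ht
    exact Finset.mem_filter.2 ⟨ht'.1, hu'.trans ht'.2.1, ht'.2.2.trans hv'⟩
  omega

end ProductPlusOne

end Summit.ValiantsHypothesis.ValiantsHypothesis.Theorems.LacunarySymmetroidMatrixDescartes
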